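import Mathlib
import Summits.Ventures.PercRepro2.Defs
import Summits.Ventures.PercRepro2.Harris
import Summits.Ventures.PercRepro2.Graph
import Summits.Ventures.PercRepro2.Events
import Summits.Ventures.PercRepro2.TReduction
import Summits.Ventures.PercRepro2.TReductionBase
import Summits.Ventures.PercRepro2.CycleDefs
import Summits.Ventures.PercRepro2.CycleTerm
import Summits.Ventures.PercRepro2.CycleDecode
import Summits.Ventures.PercRepro2.AntipodalKleitman
import Summits.Ventures.PercRepro2.CycleBase
import Summits.Ventures.PercRepro2.TCycle
import Summits.Ventures.PercRepro2.CycleHit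
import Summits.Ventures.PercRepro2.CycleCoreA
import Summits.Ventures.PercRepro2.CycleBaseA

/-!
# (T_A) on every cycle (blind cell PercRepro2, mine-a g47)

**Theorem `t_cycleA`**: on the cycle `C_{n+1}` (`CycleDefs.ends`), for every admissible weight
vector, every finite set `A` of vertices and every pair of up-sets `𝓤 𝓥` of vertex sets, with
`Q = {A ⊆ C_0}`, `U = {C_0 ∈ 𝓤}`, `e = {C_0 ∈ 𝓥}`:

  `P(Q ∩ U) P(e) + P(U) P(Q ∩ e) ≤ P(Q ∩ U ∩ e) + P(Q) P(U ∩ e)`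

— the lane's general principal form (T_A) (MINE-A.md §95.10) on cycles; `A = {h}` is `TCycle.t_cycle`.
Proof: as in `TCycle`, through `t_cluster_of_antipodal_base` and `kform_eq_antipodal_sum`; the
summand is the cast of `CycleBaseA.wtFA` at the red set (`cluster_eq_arc`,
`closedSet_baseConfig`), the red sets run over the subsets of `D`, and `CycleBaseA.sum_wtFA_nonneg`
gives the base cases.  No instance, no notation.
-/

namespace Summit.Ventures.PercRepro2

namespace TCycle

open Finset TReduction

variable {n : ℕ} {R : Type*} [Field R] [LinearOrder R] [IsStrictOrderedRing R]

omit [LinearOrder R] [IsStrictOrderedRing R] in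
open Classical in
/-- The indicator of the hit event of a set `A`, through the arc of the closed set. -/
lemma indicator_hitA (A : Finset (Fin (n + 1))) (ω : Config (Fin (n + 1))) :
    (clusterInEvent (ends n) 0 {T : Set (Fin (n + 1)) | ∀ a ∈ A, a ∈ T}).indicator
        (fun _ => (1 : R)) ω =
      ((if hitA A (arc (closedSet ω)) then (1 : ℤ) else 0 : ℤ) : R) := by
  have hmem : ω ∈ clusterInEvent (ends n) 0 {T : Set (Fin (n + 1)) | ∀ a ∈ A, a ∈ T} ↔
      hitA A (arc (closedSet ω)) := by
    rw [mem_clusterInEvent, Set.mem_setOf_eq, cluster_eq_arc]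
    rfl
  by_cases hh : hitA A (arc (closedSet ω))
  · rw [Set.indicator_of_mem (hmem.2 hh), if_pos hh]; simp
  · rw [Set.indicator_of_notMem (fun hc => hh (hmem.1 hc)), if_neg hh]; simp

omit [IsStrictOrderedRing R] in
/-- **The summand of the antipodal base case is the finset term `wtFA`** at the red set. -/
lemma summand_eq_wtFA (a : Fin (n + 1) → R) (D A : Finset (Fin (n + 1)))
    (𝓤 𝓥 : Set (Set (Fin (n + 1)))) (σ : Config (Fin (n + 1))) :
    (clusterInEvent (ends n) 0 {T : Set (Fin (n + 1)) | ∀ a ∈ A, a ∈ T}).indicator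
        (fun _ => (1 : R)) (baseConfig a D σ)
      * ((clusterInEvent (ends n) 0 𝓤).indicator (fun _ => (1 : R)) (baseConfig a D σ)
          - (clusterInEvent (ends n) 0 𝓤).indicator (fun _ => (1 : R))
              (baseConfig a D fun x => !σ x))
      * ((clusterInEvent (ends n) 0 𝓥).indicator (fun _ => (1 : R)) (baseConfig a D σ)
          - (clusterInEvent (ends n) 0 𝓥).indicator (fun _ => (1 : R))
              (baseConfig a D fun x => !σ x)) =
      ((wtFA D (pinnedClosed a D) A 𝓤 𝓥 (redSet D σ) : ℤ) : R) := by
  rw [indicator_hitA, indicator_clusterIn, indicator_clusterIn, indicator_clusterIn,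
    indicator_clusterIn, closedSet_baseConfig, closedSet_baseConfig_not]
  unfold wtFA
  push_cast
  ring

/-- **Every antipodal base case of the cycle with a hit set is nonnegative.** -/
theorem kform_nonnegA (A : Finset (Fin (n + 1))) {𝓤 𝓥 : Set (Set (Fin (n + 1)))}
    (hU : IsUpperSet 𝓤) (hV : IsUpperSet 𝓥) (D : Finset (Fin (n + 1))) (a : Fin (n + 1) → R)
    (ha : ∀ x, x ∉ D → a x = 0 ∨ a x = 1) :
    0 ≤ kform (clusterInEvent (ends n) 0 {T : Set (Fin (n + 1)) | ∀ a ∈ A, a ∈ T})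
      (clusterInEvent (ends n) 0 𝓤) (clusterInEvent (ends n) 0 𝓥) D a := by
  rw [kform_eq_antipodal_sum _ _ _ ha]
  rw [sum_congr rfl fun σ _ => summand_eq_wtFA a D A 𝓤 𝓥 σ]
  have hre : ∑ σ ∈ suppOn D, ((wtFA D (pinnedClosed a D) A 𝓤 𝓥 (redSet D σ) : ℤ) : R) =
      ((∑ τ ∈ D.powerset, wtFA D (pinnedClosed a D) A 𝓤 𝓥 τ : ℤ) : R) := by
    rw [Int.cast_sum]
    exact sum_nbij' (redSet D) (colouring D) (fun σ _ => redSet_mem_powerset D σ)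
      (fun τ _ => colouring_mem_suppOn D τ) (fun σ hσ => colouring_redSet hσ)
      (fun τ hτ => redSet_colouring hτ) (fun _ _ => rfl)
  rw [hre]
  exact Int.cast_nonneg (sum_wtFA_nonneg hU hV)

/-- **(T_A) on every cycle**: for admissible weights on the cycle `C_{n+1}`, a finite set `A` of
vertices and up-sets `𝓤 𝓥` of vertex sets, with `Q = {A ⊆ C_0}`, `U = {C_0 ∈ 𝓤}`, `e = {C_0 ∈ 𝓥}`,
`P(Q ∩ U) P(e) + P(U) P(Q ∩ e) ≤ P(Q ∩ U ∩ e) + P(Q) P(U ∩ e)`. -/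
theorem t_cycleA (p : Fin (n + 1) → R) (hp : IsProbVec p) (A : Finset (Fin (n + 1)))
    {𝓤 𝓥 : Set (Set (Fin (n + 1)))} (hU : IsUpperSet 𝓤) (hV : IsUpperSet 𝓥) :
    prob p (clusterInEvent (ends n) 0 {T : Set (Fin (n + 1)) | ∀ a ∈ A, a ∈ T}
          ∩ clusterInEvent (ends n) 0 𝓤)
        * prob p (clusterInEvent (ends n) 0 𝓥)
      + prob p (clusterInEvent (ends n) 0 𝓤)
        * prob p (clusterInEvent (ends n) 0 {T : Set (Fin (n + 1)) | ∀ a ∈ A, a ∈ T}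
            ∩ clusterInEvent (ends n) 0 𝓥) ≤
      prob p (clusterInEvent (ends n) 0 {T : Set (Fin (n + 1)) | ∀ a ∈ A, a ∈ T}
          ∩ clusterInEvent (ends n) 0 𝓤 ∩ clusterInEvent (ends n) 0 𝓥)
        + prob p (clusterInEvent (ends n) 0 {T : Set (Fin (n + 1)) | ∀ a ∈ A, a ∈ T})
          * prob p (clusterInEvent (ends n) 0 𝓤 ∩ clusterInEvent (ends n) 0 𝓥) := by
  have h := tform_nonneg_of_base
    (clusterInEvent (ends n) 0 {T : Set (Fin (n + 1)) | ∀ a ∈ A, a ∈ T})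
    (clusterInEvent (ends n) 0 𝓤) (clusterInEvent (ends n) 0 𝓥)
    (fun D a _ ha => kform_nonnegA A hU hV D a ha) p hp
  linarith [mul_comm (prob p (clusterInEvent (ends n) 0 𝓤))
    (prob p (clusterInEvent (ends n) 0 {T : Set (Fin (n + 1)) | ∀ a ∈ A, a ∈ T}
      ∩ clusterInEvent (ends n) 0 𝓥))]

end TCycle

end Summit.Ventures.PercRepro2
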